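import Summits.AtomisticToContinuum.Crystallization.Theorems.ChargedEnergyGapChartDialF

/-!
# `ChargedEnergyGap` · the CHART DIAL, part G: CHARTED SURROUND and ONE-HOP HARNACK — decomp-a2c lens-3 g38 node «ScaleCoherence» (2/3)

Energy-free shell geometry beneath `UpgradeWitness θ R M R'` (part D §4), continued from part F (cap lemmas).

§1 CHARTED SURROUND (proved, `θ ≤ 3/20`): the shell of a charted site meets every closed cone of half-angle `arccos (11/20)`
   (`exists_shell_point_inner_ge`): a matched shell point within `θ` of a rotated pattern vector at `≤ 45°` from `d` is at
   `≤ arccos (11/20) ≈ 56.6°` from `d` (`inner_ge_of_near_unit`, Gram/Cauchy–Schwarz; true angle `45° + arcsin θ ≈ 53.6°`).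
   Consequences: shell-ball distance bounds `dist_le_of_mem_shellBall` / `dist_ge_of_mem_shellBall`, and SHELL EXIT
   `exists_shell_point_closer` (for `z` outside the shell ball of a charted `p` some shell point of `p` is strictly closer to `z`).
§2 ONE-HOP HARNACK (proved, `θ ≤ 3/20`): `nn_ge_of_charted_hop` — a CHARTED site `u` in the `6/5`-shell ball of a charted
   site `p` has `nn u ≥ (3/4)·nn p`.  Proof: `u`'s shell surrounds `u` (§1), so some shell point `q` of `u` lies in the cone
   towards `p`; `q = p` forces `nn u ≥ nn p/(1 + θ)`; `q` in `p`'s shell ball forces `dist u q ≥ (1 − 2θ)·nn p` (pattern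
   separation) against `dist p q ≥ nn p`, impossible for `nn u < (3/4)·nn p` (a box inequality); `q` outside is impossible
   (`dist p q² ≤ 1.3225·nn p² < (6/5)²·nn p²`).  The scale ratio along a charted shell hop is thus in `[3/4, 23/20]`
   (`nn_hop_bounds`).
What remains of UPGRADE (part H): scale coherence along CHAINS of charted hops (no compounding zoom) — typed there as the residual.
-/


noncomputable section

open Literature.MathematicalPhysics.StatisticalMechanics
open Literature.Geometry.DiscreteGeometry
open Summit.AtomisticToContinuum.Crystallization.Theses.PricedLinkCensus
open Summit.AtomisticToContinuum.Crystallization.Theorems.ChargedEnergyGapNegative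
open RealInnerProductSpace
namespace Summit.AtomisticToContinuum.Crystallization.Theorems.ChargedEnergyGapChartDial

/-! ## §1 Charted surround -/

section surround

/-- Inner products against a unit vector `w`: `⟪x − a•w, y − b•w⟫ = ⟪x, y⟫ − b⟪x, w⟫ − a⟪w, y⟫ + ab`. -/
theorem inner_sub_smul_unit {w : E3} (hw : ‖w‖ = 1) (x y : E3) (a b : ℝ) :
    ⟪x - a • w, y - b • w⟫ = ⟪x, y⟫ - b * ⟪x, w⟫ - a * ⟪w, y⟫ + a * b := by
  have hww : ⟪w, w⟫ = 1 := by rw [real_inner_self_eq_norm_sq, hw, one_pow]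
  simp only [inner_sub_left, inner_sub_right, real_inner_smul_left, real_inner_smul_right, hww]; ring

/-- **Perturbation lemma**: if `‖w‖ = 1`, `⟪d, w⟫ ≥ ‖d‖/√2` and `‖t − w‖ ≤ θ ≤ 3/20`, then `⟪t, d⟫ ≥ (11/20)·‖t‖·‖d‖`
(Gram determinant / Cauchy–Schwarz in `w^⊥`; the true constant is `cos (45° + arcsin θ) ≈ 0.593`). -/
theorem inner_ge_of_near_unit {θ : ℝ} (hθ : θ ≤ 3 / 20) {w t d : E3} (hw : ‖w‖ = 1)
    (hwd : ‖d‖ ≤ Real.sqrt 2 * ⟪d, w⟫) (ht : ‖t - w‖ ≤ θ) :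
    11 / 20 * (‖t‖ * ‖d‖) ≤ ⟪t, d⟫ := by
  set e : E3 := t - w with he
  have hte : t = e + w := by rw [he, sub_add_cancel]
  have hD := norm_nonneg d
  have hE0 := norm_nonneg e
  have h2 : Real.sqrt 2 ^ 2 = 2 := Real.sq_sqrt (by norm_num)
  have hs2 : (0 : ℝ) < Real.sqrt 2 := by positivity
  -- scalars: `A = ⟪w, d⟫`, `α = ⟪e, w⟫`, `β = ⟪e, d⟫`, `E = ‖e‖²`, `D = ‖d‖`
  have hA0 : 0 ≤ ⟪w, d⟫ := by rw [real_inner_comm]; nlinarith only [hwd, hD, hs2]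
  have hA2 : ‖d‖ ^ 2 ≤ 2 * ⟪w, d⟫ ^ 2 := by
    rw [real_inner_comm]
    calc ‖d‖ ^ 2 ≤ (Real.sqrt 2 * ⟪d, w⟫) ^ 2 := pow_le_pow_left₀ hD hwd 2
      _ = 2 * ⟪d, w⟫ ^ 2 := by rw [mul_pow, h2]
  have hA7 : 7 / 10 * ‖d‖ ≤ ⟪w, d⟫ := by nlinarith only [hA2, hA0, hD]
  have hAle : ⟪w, d⟫ ≤ ‖d‖ := by
    have := abs_real_inner_le_norm w d; rw [hw, one_mul] at this; exact (abs_le.1 this).2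
  have hαabs : |⟪e, w⟫| ≤ ‖e‖ := by
    have := abs_real_inner_le_norm e w; rwa [hw, mul_one] at this
  have hα : -θ ≤ ⟪e, w⟫ := by have := (abs_le.1 hαabs).1; linarith
  have hE : ‖e‖ ^ 2 ≤ θ ^ 2 := pow_le_pow_left₀ hE0 ht 2
  have hθ0 : 0 ≤ θ := hE0.trans ht
  have hθ2 : θ ^ 2 ≤ 9 / 400 := by
    calc θ ^ 2 ≤ (3 / 20) ^ 2 := pow_le_pow_left₀ hθ0 hθ 2
      _ = 9 / 400 := by norm_num
  -- Gram inequality in `w^⊥`: `(β − αA)² ≤ (E − α²)(D² − A²)`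
  have hgram : (⟪e, d⟫ - ⟪e, w⟫ * ⟪w, d⟫) ^ 2 ≤ (‖e‖ ^ 2 - ⟪e, w⟫ ^ 2) * (‖d‖ ^ 2 - ⟪w, d⟫ ^ 2) := by
    have hcs := real_inner_mul_inner_self_le (e - ⟪e, w⟫ • w) (d - ⟪w, d⟫ • w)
    have h1 : ⟪e - ⟪e, w⟫ • w, d - ⟪w, d⟫ • w⟫ = ⟪e, d⟫ - ⟪e, w⟫ * ⟪w, d⟫ := by
      rw [inner_sub_smul_unit hw]; ring
    have h2' : ⟪e - ⟪e, w⟫ • w, e - ⟪e, w⟫ • w⟫ = ‖e‖ ^ 2 - ⟪e, w⟫ ^ 2 := by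
      rw [inner_sub_smul_unit hw, real_inner_self_eq_norm_sq, real_inner_comm w e]; ring
    have h3 : ⟪d - ⟪w, d⟫ • w, d - ⟪w, d⟫ • w⟫ = ‖d‖ ^ 2 - ⟪w, d⟫ ^ 2 := by
      rw [inner_sub_smul_unit hw, real_inner_self_eq_norm_sq, real_inner_comm w d]; ring
    rw [h1, h2', h3] at hcs; rw [sq]; exact hcs
  -- crude consequences: `β ≥ αA − (11/100)·D`
  have hperp : ‖d‖ ^ 2 - ⟪w, d⟫ ^ 2 ≤ ‖d‖ ^ 2 / 2 := by linarith only [hA2]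
  have hEα : ‖e‖ ^ 2 - ⟪e, w⟫ ^ 2 ≤ 9 / 400 := by linarith only [hE, hθ2, sq_nonneg ⟪e, w⟫]
  have hDA0 : 0 ≤ ‖d‖ ^ 2 - ⟪w, d⟫ ^ 2 := by
    have := pow_le_pow_left₀ hA0 hAle 2; linarith only [this]
  have hsq : (⟪e, d⟫ - ⟪e, w⟫ * ⟪w, d⟫) ^ 2 ≤ 9 / 800 * ‖d‖ ^ 2 := by
    calc (⟪e, d⟫ - ⟪e, w⟫ * ⟪w, d⟫) ^ 2 ≤ (‖e‖ ^ 2 - ⟪e, w⟫ ^ 2) * (‖d‖ ^ 2 - ⟪w, d⟫ ^ 2) := hgram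
      _ ≤ 9 / 400 * (‖d‖ ^ 2 / 2) := mul_le_mul hEα hperp hDA0 (by norm_num)
      _ = 9 / 800 * ‖d‖ ^ 2 := by ring
  have hβ : ⟪e, w⟫ * ⟪w, d⟫ - 11 / 100 * ‖d‖ ≤ ⟪e, d⟫ := by nlinarith only [hsq, hD]
  -- `⟪t, d⟫ = A + β ≥ A(1 + α) − 0.11 D ≥ (0.7(1 + α) − 0.11)·D`
  have htd : ⟪t, d⟫ = ⟪w, d⟫ + ⟪e, d⟫ := by rw [hte, inner_add_left]; ring
  have h1α : 0 ≤ 1 + ⟪e, w⟫ := by linarith only [hα, hθ]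
  have hL : (7 / 10 * (1 + ⟪e, w⟫) - 11 / 100) * ‖d‖ ≤ ⟪t, d⟫ := by
    have := mul_le_mul_of_nonneg_left hA7 h1α
    rw [htd]; linarith only [this, hβ]
  -- `‖t‖² = 1 + 2α + E`
  have hT : ‖t‖ ^ 2 = ‖e‖ ^ 2 + 2 * ⟪e, w⟫ + 1 := by
    rw [hte, norm_add_sq_real, hw]; ring
  -- the final quadratic: `(0.7(1+α) − 0.11)² ≥ 0.3025·(1 + 2α + E)`
  have hquad : (11 / 20 * ‖t‖) ^ 2 ≤ (7 / 10 * (1 + ⟪e, w⟫) - 11 / 100) ^ 2 := by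
    rw [mul_pow, hT]; nlinarith only [hE, hθ2, hα, hθ, sq_nonneg (⟪e, w⟫ + 9 / 40)]
  have hL0 : 0 ≤ 7 / 10 * (1 + ⟪e, w⟫) - 11 / 100 := by linarith only [hα, hθ]
  have hmain : 11 / 20 * ‖t‖ ≤ 7 / 10 * (1 + ⟪e, w⟫) - 11 / 100 :=
    (le_abs_self _).trans (abs_le_of_sq_le_sq hquad hL0)
  calc 11 / 20 * (‖t‖ * ‖d‖) = (11 / 20 * ‖t‖) * ‖d‖ := by ring
    _ ≤ (7 / 10 * (1 + ⟪e, w⟫) - 11 / 100) * ‖d‖ := mul_le_mul_of_nonneg_right hmain hD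
    _ ≤ ⟪t, d⟫ := hL

variable (Q : PeriodicConfiguration 3)

/-- A point of the shell ball of a charted site lies at normalised distance `≤ 1 + θ`. -/
theorem dist_le_of_mem_shellBall {θ : ℝ} {p q : Q.points} (hp : ChartedAt θ Q p) (hqp : q ≠ p)
    (hq : dist (p : E3) q ≤ 6 / 5 * nn Q p) : dist (p : E3) q ≤ (1 + θ) * nn Q p := by
  obtain ⟨T, hT, hB1, -⟩ := chartedAt_bounds hp
  have hc : 0 < nn Q p := Blocks.nearestDist_pt_pos Q p
  have hmem : shellCoord Q p q ∈ T := by rw [← Finset.mem_coe, hT]; exact shellCoord_mem Q hqp hq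
  rw [dist_eq_nn_mul_norm_shellCoord, mul_comm]
  exact mul_le_mul_of_nonneg_right (hB1 _ hmem) hc.le

/-- Two distinct points of the shell ball of a charted site are at distance `≥ (1 − 2θ)·nn`. -/
theorem dist_ge_of_mem_shellBall {θ : ℝ} {p q r : Q.points} (hp : ChartedAt θ Q p) (hqp : q ≠ p) (hrp : r ≠ p)
    (hqr : q ≠ r) (hq : dist (p : E3) q ≤ 6 / 5 * nn Q p) (hr : dist (p : E3) r ≤ 6 / 5 * nn Q p) :
    (1 - 2 * θ) * nn Q p ≤ dist (q : E3) r := by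
  obtain ⟨T, hT, -, hB2⟩ := chartedAt_bounds hp
  have hc : 0 < nn Q p := Blocks.nearestDist_pt_pos Q p
  have hmq : shellCoord Q p q ∈ T := by rw [← Finset.mem_coe, hT]; exact shellCoord_mem Q hqp hq
  have hmr : shellCoord Q p r ∈ T := by rw [← Finset.mem_coe, hT]; exact shellCoord_mem Q hrp hr
  have hne : shellCoord Q p q ≠ shellCoord Q p r := fun h => hqr (Subtype.ext (shellCoord_injective Q p h))
  have h := mul_le_mul_of_nonneg_left (hB2 _ hmq _ hmr hne) hc.le
  rw [dist_eq_nn_mul_dist_shellCoord Q p]; linarith only [h]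

/-- **CHARTED SURROUND** (`θ ≤ 3/20`): for every direction `d` the shell of a charted site `u` has a point `q` in the closed
cone of half-angle `arccos (11/20)` about `d`: `⟪q − u, d⟫ ≥ (11/20)·‖q − u‖·‖d‖`. -/
theorem exists_shell_point_inner_ge {θ : ℝ} (hθ : θ ≤ 3 / 20) {u : Q.points} (hu : ChartedAt θ Q u) (d : E3) :
    ∃ q : Q.points, q ≠ u ∧ dist (u : E3) q ≤ 6 / 5 * nn Q u ∧
      11 / 20 * (‖(q : E3) - u‖ * ‖d‖) ≤ ⟪(q : E3) - u, d⟫ := by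
  obtain ⟨T, hT, hclose⟩ := hu
  have hc : 0 < nn Q u := Blocks.nearestDist_pt_pos Q u
  -- unpack the chart: pattern `P`, isometry `A`, matching `e`
  obtain ⟨P, hP, A, e, he⟩ : ∃ P : Finset E3, (P = fccKissingPattern ∨ P = hcpKissingPattern) ∧
      ∃ (A : E3 →ₗᵢ[ℝ] E3) (e : ↥T ≃ ↥(P.image A)), ∀ t : ↥T, dist (t : E3) (e t : E3) ≤ θ := by
    rcases hclose with ⟨A, e, he⟩ | ⟨A, e, he⟩
    · exact ⟨_, Or.inl rfl, A, e, he⟩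
    · exact ⟨_, Or.inr rfl, A, e, he⟩
  have hP1 : ∀ v ∈ P, ‖v‖ = 1 := by
    rcases hP with rfl | rfl
    · exact fun v hv => norm_eq_one_of_mem_fccKissingPattern hv
    · exact fun v hv => norm_eq_one_of_mem_hcpKissingPattern hv
  -- pull `d` back through `A` and apply the cap lemma
  let Ae : E3 ≃ₗᵢ[ℝ] E3 := A.toLinearIsometryEquiv rfl
  have hAe : ∀ v, Ae v = A v := fun v => rfl
  obtain ⟨w, hw, hwd⟩ := exists_mem_pattern_inner_ge hP (Ae.symm d)
  have hwd' : ‖d‖ ≤ Real.sqrt 2 * ⟪d, A w⟫ := by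
    have h1 : ⟪Ae.symm d, w⟫ = ⟪d, A w⟫ := by
      rw [← hAe, ← Ae.inner_map_map (Ae.symm d) w, LinearIsometryEquiv.apply_symm_apply]
    rwa [LinearIsometryEquiv.norm_map, h1] at hwd
  have hw1 : ‖A w‖ = 1 := by rw [A.norm_map, hP1 w hw]
  -- the matched shell point
  have hAw : A w ∈ P.image A := Finset.mem_image_of_mem _ hw
  set t : ↥T := e.symm ⟨A w, hAw⟩ with htdef
  have het : (e t : E3) = A w := by rw [htdef, Equiv.apply_symm_apply]
  have hdist : ‖(t : E3) - A w‖ ≤ θ := by rw [← dist_eq_norm, ← het]; exact he t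
  have hkey := inner_ge_of_near_unit hθ hw1 hwd' hdist
  -- `t` is the normalised position of a shell point `q`
  have htmem : (t : E3) ∈ shellSet Q u := by rw [← hT]; exact t.2
  obtain ⟨q, ⟨hqQ, hqu, hqd⟩, hqt⟩ := htmem
  refine ⟨⟨q, hqQ⟩, fun h => hqu (congrArg Subtype.val h), hqd, ?_⟩
  have hq' : (q : E3) - u = nn Q u • (t : E3) := by
    rw [← hqt, smul_smul, mul_inv_cancel₀ hc.ne', one_smul]
  show 11 / 20 * (‖q - (u : E3)‖ * ‖d‖) ≤ ⟪q - (u : E3), d⟫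
  rw [hq', norm_smul, Real.norm_of_nonneg hc.le, real_inner_smul_left]
  calc 11 / 20 * (nn Q u * ‖(t : E3)‖ * ‖d‖) = nn Q u * (11 / 20 * (‖(t : E3)‖ * ‖d‖)) := by ring
    _ ≤ nn Q u * ⟪(t : E3), d⟫ := mul_le_mul_of_nonneg_left hkey hc.le

/-- **SHELL EXIT** (`θ ≤ 3/20`): towards any point `z` outside its `6/5`-shell ball a charted site `p` has a shell point
strictly closer to `z`. -/
theorem exists_shell_point_closer {θ : ℝ} (hθ : θ ≤ 3 / 20) {p : Q.points} (hp : ChartedAt θ Q p) {z : E3}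
    (hz : 6 / 5 * nn Q p < dist (p : E3) z) :
    ∃ q : Q.points, q ≠ p ∧ dist (p : E3) q ≤ 6 / 5 * nn Q p ∧ dist (q : E3) z < dist (p : E3) z := by
  obtain ⟨q, hqp, hqd, hin⟩ := exists_shell_point_inner_ge Q hθ hp (z - p)
  refine ⟨q, hqp, hqd, ?_⟩
  have hc : 0 < nn Q p := Blocks.nearestDist_pt_pos Q p
  have hs0 : 0 < ‖(q : E3) - p‖ := by
    rw [← dist_eq_norm, dist_comm]; exact lt_of_lt_of_le hc (nearestDist_le_dist Subtype.val hqp)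
  have hs1 : ‖(q : E3) - p‖ ≤ 6 / 5 * nn Q p := by rwa [← dist_eq_norm, dist_comm]
  have hD : dist (p : E3) z = ‖z - (p : E3)‖ := by rw [dist_comm, dist_eq_norm]
  have hsq : dist (q : E3) z ^ 2 = ‖z - (p : E3)‖ ^ 2 - 2 * ⟪z - (p : E3), (q : E3) - p⟫ + ‖(q : E3) - p‖ ^ 2 := by
    rw [dist_eq_norm, show (q : E3) - z = -((z - p) - ((q : E3) - p)) by abel, norm_neg, norm_sub_sq_real]
  rw [real_inner_comm] at hsq
  rw [hD] at hz ⊢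
  have hgap : 0 < 11 / 10 * ‖z - (p : E3)‖ - ‖(q : E3) - p‖ := by linarith only [hz, hs1, hc]
  have hlt : dist (q : E3) z ^ 2 < ‖z - (p : E3)‖ ^ 2 := by
    rw [hsq]; nlinarith only [mul_pos hs0 hgap, hin]
  exact lt_of_pow_lt_pow_left₀ 2 (norm_nonneg _) hlt

end surround

/-! ## §2 One-hop Harnack -/

section hop

variable (Q : PeriodicConfiguration 3)

/-- **ONE-HOP HARNACK** (`θ ≤ 3/20`): a charted site `u` in the `6/5`-shell ball of a charted site `p` has comparable own
scale, `nn u ≥ (3/4)·nn p` — no zoom by more than `4/3` across one charted shell hop. -/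
theorem nn_ge_of_charted_hop {θ : ℝ} (hθ : θ ≤ 3 / 20) {p u : Q.points} (hp : ChartedAt θ Q p) (hu : ChartedAt θ Q u)
    (hup : u ≠ p) (hd : dist (p : E3) u ≤ 6 / 5 * nn Q p) : 3 / 4 * nn Q p ≤ nn Q u := by
  have hcp : 0 < nn Q p := Blocks.nearestDist_pt_pos Q p
  have hcu : 0 < nn Q u := Blocks.nearestDist_pt_pos Q u
  by_contra hlt
  push Not at hlt
  -- `r = dist p u ∈ [nn p, (1+θ) nn p]`
  have hr1 : nn Q p ≤ dist (p : E3) u := nearestDist_le_dist Subtype.val hup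
  have hr2 : dist (p : E3) u ≤ (1 + θ) * nn Q p := dist_le_of_mem_shellBall Q hp hup hd
  -- the shell point of `u` towards `p`
  obtain ⟨q, hqu, hqd, hin⟩ := exists_shell_point_inner_ge Q hθ hu ((p : E3) - u)
  have hs1 : nn Q u ≤ dist (u : E3) q := nearestDist_le_dist Subtype.val hqu
  have hs2 : dist (u : E3) q ≤ (1 + θ) * nn Q u := dist_le_of_mem_shellBall Q hu hqu hqd
  -- the law of cosines: `dist p q² = r² + s² − 2⟪q − u, p − u⟫ ≤ r² + s² − (11/10) r s`
  have hsq : dist (p : E3) q ^ 2 =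
      dist (p : E3) u ^ 2 - 2 * ⟪(p : E3) - u, (q : E3) - u⟫ + dist (u : E3) q ^ 2 := by
    rw [dist_eq_norm, dist_eq_norm, dist_comm, dist_eq_norm,
      show (p : E3) - q = ((p : E3) - u) - ((q : E3) - u) by abel, norm_sub_sq_real]
  rw [real_inner_comm] at hsq
  have hru : ‖(q : E3) - u‖ = dist (u : E3) q := by rw [dist_comm, dist_eq_norm]
  have hrp : ‖(p : E3) - u‖ = dist (p : E3) u := by rw [dist_eq_norm]
  rw [hru, hrp] at hin
  have hcos : dist (p : E3) q ^ 2 ≤ dist (p : E3) u ^ 2 + dist (u : E3) q ^ 2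
      - 11 / 10 * (dist (u : E3) q * dist (p : E3) u) := by rw [hsq]; linarith
  -- abbreviations for the box argument
  set r := dist (p : E3) u with hrdef
  set s := dist (u : E3) q with hsdef
  set n := nn Q p with hndef
  have hr2' : r ≤ 23 / 20 * n := by nlinarith
  have hs2' : s ≤ 69 / 80 * n := by nlinarith
  have hs0 : 0 ≤ s := dist_nonneg
  by_cases hqp : q = p
  · -- `q = p`: `s = r ≥ n` against `s < 0.8625 n`
    have : s = r := by rw [hsdef, hrdef, hqp, dist_comm]
    nlinarith
  by_cases hball : dist (p : E3) q ≤ 6 / 5 * n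
  · -- `q` in the shell ball of `p`: `dist p q ≥ n` and `s = dist u q ≥ (1 − 2θ) n ≥ 0.7 n`
    have h1 : n ≤ dist (p : E3) q := nearestDist_le_dist Subtype.val hqp
    have h2 : (1 - 2 * θ) * n ≤ s := dist_ge_of_mem_shellBall Q hp hup hqp (Ne.symm hqu) hd hball
    have h2' : 7 / 10 * n ≤ s := by nlinarith
    have hn2 : n ^ 2 ≤ dist (p : E3) q ^ 2 := pow_le_pow_left₀ hcp.le h1 2
    nlinarith [mul_nonneg (sub_nonneg.2 hr1) (sub_nonneg.2 hr2'), mul_nonneg (sub_nonneg.2 h2') (sub_nonneg.2 hs2'),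
      mul_nonneg (sub_nonneg.2 hr2') (sub_nonneg.2 hs2'), mul_nonneg hcp.le (sub_nonneg.2 hr2'),
      mul_nonneg hcp.le (sub_nonneg.2 hs2'), mul_pos hcp hcp]
  · -- `q` outside: `dist p q² > 1.44 n²` against `≤ 1.3225 n²`
    push Not at hball
    have hn2 : (6 / 5 * n) ^ 2 < dist (p : E3) q ^ 2 := pow_lt_pow_left₀ hball (by positivity) two_ne_zero
    nlinarith [mul_nonneg (sub_nonneg.2 hr1) (sub_nonneg.2 hr2'), mul_nonneg hs0 (sub_nonneg.2 hs2'),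
      mul_nonneg (sub_nonneg.2 hr1) hs0, mul_nonneg hcp.le hs0, mul_pos hcp hcp]

/-- The two-sided form: scale ratios along a charted shell hop lie in `[3/4, 1 + θ] ⊆ [3/4, 23/20]`. -/
theorem nn_hop_bounds {θ : ℝ} (hθ : θ ≤ 3 / 20) {p u : Q.points} (hp : ChartedAt θ Q p) (hu : ChartedAt θ Q u)
    (hup : u ≠ p) (hd : dist (p : E3) u ≤ 6 / 5 * nn Q p) :
    3 / 4 * nn Q p ≤ nn Q u ∧ nn Q u ≤ (1 + θ) * nn Q p :=
  ⟨nn_ge_of_charted_hop Q hθ hp hu hup hd,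
    (by rw [dist_comm]; exact nearestDist_le_dist Subtype.val hup.symm : nn Q u ≤ dist (p : E3) u).trans
      (dist_le_of_mem_shellBall Q hp hup hd)⟩

end hop

end Summit.AtomisticToContinuum.Crystallization.Theorems.ChargedEnergyGapChartDial

end
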